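import Mathlib.Analysis.PSeries
import Mathlib.Analysis.SpecialFunctions.Pow.Real
import Summits.QuantumFields.BalabanUV.T4Continuum.Support.NE7MarginalL1Assembly

/-!
# Spine/NE4/ScaleShiftRemnant — NE4 UP TO A NON-CONTRACTING ULTRAVIOLET REMNANT: node U2 → U6 still closes, in the
# tree's ℓ¹ currency, when `ScaleShiftRate`'s geometric bound is contaminated by a term depending only on the CUTOFF
# (the run length, or the BARE coupling), provided that term is summable over cutoffs — exponent `> 2` in the bare
# coupling, and `2` is the threshold (cell `pub-balaban-gaps`, seat ne4, generation 19; census item (R62) of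
# `HOME/ne/NE4.md` §5)

HONEST FRAMING.  Bookkeeping for rung (B)+1 on ONE FIXED finite four-torus (existence AND uniqueness of the ε → 0 limit
of gauge-invariant observables) — NOT ℝ⁴, NOT infinite volume, NOT a mass gap, NOT Clay.  NE4 =
`T4CouplingMatching.ScaleShiftRate` (the β-functions forget the ultraviolet cutoff geometrically) is NOT PRINTED in
[Balaban1987RG1]–[Balaban1988Convergent] and NOT PROVED here; spine estimates proved 0∕9, unchanged by this module.
Every hypothesis on `β` below is an UNPRINTED input; nothing of Bałaban's is instantiated or asserted.  0 `def`, 0 sorry.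

WHY (the in-print sibling of the device).  The one printed continuum-limit proof for an ASYMPTOTICALLY FREE BOSONIC
block-spin model, [GawedzkiKupiainen1986] §5 pp. 545–547 (hierarchical O(N) σ-model, d = 2), uses node U2's device
verbatim — «We need to vary M in a = L^{−M} … δF_m(M) = F_m(M+1) − F_m(M)» (p. 545), telescoping (90)
`F_m(∞) = F_m(m+1) + Σ_{M>m} δF_m(M)` — and PRINTS the rate law of the cutoff variation at fixed scale `m`:
`δ_m ≡ L^{−(M−m)} + β(M)^{−3∕2+ε}` ((84); (87)–(89)), summed as (91)
`Σ_{M>m} O(δ_m(M)) ≤ Σ_{M>m} (O(L^{−(M−m)}) + O(M^{−(3+ε)∕2})) < ∞`: GEOMETRIC in the number of steps below the cutoff PLUS a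
summable power of the BARE coupling `g_0² = β(M)^{−1}` (there the bare ansatz (14) pins the runs at the ultraviolet end, and
the second term is that pinning's remnant, propagated down the scales without contraction).  The spine's node U2 asks for the
purely geometric `ScaleShiftRate c θ γ β` and its K-uniform geometric output `T4CauchySum.InjectedRate C 0 θ`; the printed
sibling law is NOT of that form.  THIS FILE records, by name over the tree's ℓ¹ road (`NE7MarginalL1Currency ∕ Runs ∕
Assembly`, lineage t4-ne7-p1), exactly how much of such a non-contracting remnant node U2 → U6 tolerates:

* §1 `shiftAlong_of_geom_add_remnant` ∕ `summable_geom_add_remnant` — an along-run β-shift bound «`c·θ^j + r(K+1)`» with a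
  remnant `r` depending only on the RUN LENGTH (the cutoff), antitone on positive lengths, is the ℓ¹ road's `ShiftAlongRun σ`
  with the K-INDEPENDENT profile `σ_j = c·θ^j + r(j+2)`, summable iff `r` is.
* §2 `u6_of_runs_remnant` — hence node U6's outputs (`Summable δ`, Cauchy and uniformly convergent generating functions)
  along IR-pinned eventually-AF runs with history moduli of fading memory and the tree's window, from «geometric + summable
  run-length remnant» in place of NE4 (composition with `NE7MarginalL1Assembly.u6_of_runs_fadingMemory`).
* §3 `bare_rpow_le_of_betaLower` ∕ `shiftAlong_of_bareRemnant` ∕ `u6_of_runs_bareRemnant` — the β-LEVEL form: NE4 weakened ON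
  THE BOX to `|β_{k+2}(g_0,…,g_{k+1}) − β_{k+1}(g_1,…,g_{k+1})| ≤ c·θ^k + R·g_0^κ` (a remnant in the OLDEST coupling — the one
  unpaired ultraviolet scale of the comparison); along runs of (0.20) pinned at one renormalized coupling with the all-k
  lower bound `b ≤ β` ((0.31)'s lower half FROM THE CUTOFF ON — an eventual lower bound leaves the first bare couplings, hence
  the remnant, uncontrolled) the bare coupling of the run of length `K` obeys `g_0^κ ≤ (bK)^{−κ∕2}`, so §2 applies with
  `r(K) = R·(bK)^{−κ∕2}`, summable for `κ > 2`.
* §4 `summable_bareRemnant_iff` — `Σ_K R·(bK)^{−κ∕2} < ∞ ⟺ κ > 2` (p-series); at `κ = 2` the profile of §1 is harmonic and the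
  ℓ¹ road's threshold is crossed (`NE7MarginalL1Currency.thresholdExact`, `NE7MarginalL1Strict.not_summable_delta_tailInj_harmonic`:
  for a non-summable profile the equality-case injection has non-summable transported totals).  [GawedzkiKupiainen1986]'s
  printed exponent `3 − 2ε` ((81), (84)) lies in the admissible range; [Balaban1988Convergent] Thm 2 (2.44) prints its
  non-contracted large-field sizes as `R₁ g_j^{κ₀}` — booked on the expectation side by row NE9's
  `DirectPairingUVTail.uvTailR_le` with the same p-series (`κ₀ > 2`).

WHAT THIS SAYS FOR THE ROW (census (R62); complements (R9)∕(R9′) «summable envelopes IN k» and (R22) «a remainder sized by the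
CURRENT coupling fails at the pinned infrared end»): a remnant sized by the BARE coupling sits at the ultraviolet end, where
asymptotic freedom makes it small along every run, uniformly in the scale; NE4 PROPER (a rate) is then owed only for the part
of the β-shift that is not so sized.  Whether Bałaban's β-functions carry such a remnant at matched histories is NOT claimed
either way (print is silent: [Balaban1987RG1] p. 264).  No status word moves: NE4 DEPENDENT (⇐ NE5 ∧ (AF-0r)); NOT IN PRINT;
NOT PROVED; 0∕9.  HONEST DEPENDENCY (cell, verbatim): continuum YM on T⁴ ⇐ BetaPertH ∧ nine spine estimates (0∕9 proved);
BetaPertH ⇐ (D1) ∧ (D4) ∧ CAP+tail.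

References (TYPES ∕ templates only): [GawedzkiKupiainen1986] = K. Gawędzki, A. Kupiainen, Commun. Math. Phys. **106** (1986)
533–550, §5 (80)–(91) pp. 545–546; [Balaban1987RG1] = T. Bałaban, Commun. Math. Phys. **109** (1987) 249–301, (0.20) p. 256,
(0.31) p. 259, p. 264; [Balaban1988Convergent] = T. Bałaban, Commun. Math. Phys. **119** (1988) 243–285, Thm 2 (2.43)–(2.44)
p. 263; [King1986] = C. King, Commun. Math. Phys. **102** (1986) 649–677, Thm 3.4 (3.9) p. 656 (the geometric template).
-/

noncomputable section

open Finset Filter Topology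

namespace Summit.QuantumFields.BalabanUV.T4Continuum.Spine.NE4.ScaleShiftRemnant

open Literature.MathematicalPhysics.QuantumFieldTheory.Balaban1983to89
open Literature.MathematicalPhysics.QuantumFieldTheory.Balaban1983to89.FlowStep
open T4CauchySum (delta MatchingModConstants genFun genFunLim)
open T4CouplingMatching (disc HistLipschitz FadingMemory EventualLowerH prefixOf_mem_box)
open NE7MarginalL1Currency (ShiftAlongRun)
open NE7MarginalL1Assembly (u6_of_runs_fadingMemory)

/-! ## §1 The along-run profile of «geometric + run-length remnant» -/

/-- **A RUN-LENGTH REMNANT IS AN ℓ¹-ROAD PROFILE.**  If along every run `g (K+1)` (length `K+1`) the two-depth β-shift at scale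
`j < K` is at most `c·θ^j + r(K+1)` — a geometric part plus a remnant depending only on the run length, `r` antitone on
positive lengths — then the ℓ¹ road's `ShiftAlongRun σ β (g (K+1)) K` holds for every `K` with the K-INDEPENDENT profile
`σ_j = c·θ^j + r(j+2)` (since `j + 2 ≤ K + 1`).  The shape of [GawedzkiKupiainen1986] (84) `δ_m = L^{−(M−m)} + β(M)^{−3∕2+ε}`,
read at fixed scale as a function of the cutoff. [cite: GawedzkiKupiainen1986, §5 (84) p.545] -/
theorem shiftAlong_of_geom_add_remnant {β : HBeta} {c θ : ℝ} {r : ℕ → ℝ} {g : ℕ → ℕ → ℝ}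
    (hr : ∀ m n : ℕ, 1 ≤ m → m ≤ n → r n ≤ r m)
    (hS : ∀ K j, j < K →
      |β (j + 1) (prefixOf (g (K + 1)) (j + 1)) - β j (Fin.tail (prefixOf (g (K + 1)) (j + 1)))| ≤ c * θ ^ j + r (K + 1)) :
    ∀ K, ShiftAlongRun (fun j => c * θ ^ j + r (j + 2)) β (g (K + 1)) K := by
  intro K j hj
  have hmono : r (K + 1) ≤ r (j + 2) := hr (j + 2) (K + 1) (by omega) (by omega)
  refine (hS K j hj).trans ?_
  dsimp only
  linarith

/-- The profile `σ_j = c·θ^j + r(j+2)` is nonnegative for `c, θ ≥ 0`, `r ≥ 0`. [folklore] -/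
theorem geom_add_remnant_nonneg {c θ : ℝ} {r : ℕ → ℝ} (hc : 0 ≤ c) (hθ0 : 0 ≤ θ) (hr0 : ∀ n, 0 ≤ r n) (j : ℕ) :
    0 ≤ c * θ ^ j + r (j + 2) :=
  add_nonneg (mul_nonneg hc (pow_nonneg hθ0 j)) (hr0 _)

/-- The profile `σ_j = c·θ^j + r(j+2)` is summable when `0 ≤ θ < 1` and the remnant is summable over run lengths — the
telescoping (90)–(91) of [GawedzkiKupiainen1986] in the tree's currency. [cite: GawedzkiKupiainen1986, §5 (90)-(91) pp.545-546] -/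
theorem summable_geom_add_remnant {c θ : ℝ} {r : ℕ → ℝ} (hθ0 : 0 ≤ θ) (hθ1 : θ < 1) (hrs : Summable r) :
    Summable (fun j => c * θ ^ j + r (j + 2)) :=
  ((summable_geometric_of_lt_one hθ0 hθ1).mul_left c).add ((summable_nat_add_iff 2).mpr hrs)

/-! ## §2 Node U2 → U6 from «geometric + summable run-length remnant» -/

/-- **U2 → U6 WITH A NON-CONTRACTING REMNANT (ℓ¹ currency, genuine fading memory).**  A family `g K` of runs of (0.20) of
lengths `K`, couplings in `]0,γ]`, pinned at one renormalized coupling `gIR`; history moduli `HistLipschitz Λ γ β` with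
`FadingMemory C ω Λ` (`0 < ω < 1`); `EventualLowerH b γ k₀ β` with the tree's smallness `C((k₀+1)γ³ + 2γ∕b) ≤ (1−ω)∕2`; and,
IN PLACE OF NE4, the along-run β-shift bound `c·θ^j + r(K+1)` (`0 ≤ θ < 1`, `c ≥ 0`, remnant `r ≥ 0` antitone on positive run
lengths and SUMMABLE).  THEN node U6's outputs for any contraction `ρ ∈ [0,1[` and node-U5 datum `Z`: the transported coupling
discrepancies are summable over cutoffs, every generating function `K ↦ genFun Z K t` is Cauchy, and the convergence is uniform on
`|t| ≤ l₀`.  (`u6_of_runs_fadingMemory` ∘ §1.)  Every hypothesis is an UNPRINTED input; the remnant shape is the printed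
sibling's [GawedzkiKupiainen1986] (84)∕(91). [cite: GawedzkiKupiainen1986, §5 (84), (90)-(91) pp.545-546] -/
theorem u6_of_runs_remnant {β : HBeta} {γ b ω C E ρ vol l₀ c θ : ℝ} {Λ : ℕ → ℕ → ℝ} {r : ℕ → ℝ} {k₀ : ℕ} {Z : ℕ → ℝ → ℝ}
    (g : ℕ → ℕ → ℝ) (gIR : ℝ) (hγ : 0 < γ) (hb : 0 < b) (hω0 : 0 < ω) (hω1 : ω < 1) (hC : 0 ≤ C)
    (hc : 0 ≤ c) (hθ0 : 0 ≤ θ) (hθ1 : θ < 1) (hr0 : ∀ n, 0 ≤ r n) (hr : ∀ m n : ℕ, 1 ≤ m → m ≤ n → r n ≤ r m)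
    (hrs : Summable r)
    (hrun : ∀ K, RGEqH K β (g K)) (hbox : ∀ K i, i ≤ K → 0 < g K i ∧ g K i ≤ γ) (hpin : ∀ K, g K K = gIR)
    (hS : ∀ K j, j < K →
      |β (j + 1) (prefixOf (g (K + 1)) (j + 1)) - β j (Fin.tail (prefixOf (g (K + 1)) (j + 1)))| ≤ c * θ ^ j + r (K + 1))
    (hL : HistLipschitz Λ γ β) (hΛ : FadingMemory C ω Λ) (hlo : EventualLowerH b γ k₀ β)
    (hsmall : C * (((k₀ : ℝ) + 1) * γ ^ 3 + 2 * γ / b) ≤ (1 - ω) / 2)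
    (hE : 0 ≤ E) (hρ0 : 0 ≤ ρ) (hρ1 : ρ < 1) (hl₀ : 0 ≤ l₀)
    (hU5 : MatchingModConstants vol l₀ (delta E ρ (fun K j => disc (g K) (g (K + 1)) j)) Z) :
    Summable (delta E ρ (fun K j => disc (g K) (g (K + 1)) j)) ∧
    (∀ t : ℝ, |t| ≤ l₀ → CauchySeq fun K => genFun Z K t) ∧
    TendstoUniformlyOn (fun K t => genFun Z K t) (genFunLim Z) atTop {t | |t| ≤ l₀} :=
  u6_of_runs_fadingMemory g gIR hγ hb hω0 hω1 hC (geom_add_remnant_nonneg hc hθ0 hr0)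
    (summable_geom_add_remnant hθ0 hθ1 hrs) hrun hbox hpin (shiftAlong_of_geom_add_remnant hr hS) hL hΛ hlo hsmall
    hE hρ0 hρ1 hl₀ hU5

/-! ## §3 The β-level form: NE4 up to a remnant in the bare coupling -/

/-- **ASYMPTOTIC FREEDOM AT THE ULTRAVIOLET END.**  Along a run of (0.20) of length `K` with couplings in `]0,γ]` under the all-k
lower bound `b ≤ β` (`FlowStep.BetaLowerH b γ β`, `b > 0` — (0.31)'s lower half from the cutoff on, an UNPRINTED input), the
bare coupling satisfies `g_0^κ ≤ (b·K)^{−κ∕2}` for every real `κ ≥ 0` (from `1∕g_K² + bK ≤ 1∕g_0²`,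
`T4CouplingMatching.inv_sq_lower_of_betaLower`). [cite: Balaban1987RG1, (0.31) p.259] -/
theorem bare_rpow_le_of_betaLower {β : HBeta} {γ b κ : ℝ} {K : ℕ} {g : ℕ → ℝ} (hb : 0 < b) (hκ : 0 ≤ κ) (hK : 1 ≤ K)
    (h : RGEqH K β g) (hbox : ∀ i, i ≤ K → 0 < g i ∧ g i ≤ γ) (hlo : BetaLowerH b γ β) :
    (g 0) ^ κ ≤ (b * (K : ℝ)) ^ (-(κ / 2)) := by
  have hx0 : 0 < g 0 := (hbox 0 (Nat.zero_le K)).1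
  have hA : 0 < b * (K : ℝ) := mul_pos hb (by exact_mod_cast hK)
  have htel : 1 / (g K) ^ 2 + b * ((K - 0 : ℕ) : ℝ) ≤ 1 / (g 0) ^ 2 :=
    T4CouplingMatching.inv_sq_lower_of_betaLower h hbox hlo (Nat.zero_le K)
  have hKsub : ((K - 0 : ℕ) : ℝ) = (K : ℝ) := by rw [Nat.sub_zero]
  rw [hKsub] at htel
  have hIR : 0 ≤ 1 / (g K) ^ 2 := by positivity
  have hA' : b * (K : ℝ) ≤ 1 / (g 0) ^ 2 := by linarith
  -- `g_0² ≤ 1∕(bK)`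
  have hsq : (g 0) ^ 2 ≤ 1 / (b * (K : ℝ)) := by
    rw [le_div_iff₀ hA]
    calc (g 0) ^ 2 * (b * (K : ℝ)) ≤ (g 0) ^ 2 * (1 / (g 0) ^ 2) := mul_le_mul_of_nonneg_left hA' (sq_nonneg _)
      _ = 1 := by rw [mul_one_div, div_self (pow_ne_zero 2 hx0.ne')]
  -- raise to the power `κ∕2`
  have hpow : ((g 0) ^ 2) ^ (κ / 2) ≤ (1 / (b * (K : ℝ))) ^ (κ / 2) :=
    Real.rpow_le_rpow (sq_nonneg _) hsq (by linarith)
  have hlhs : (g 0) ^ κ = ((g 0) ^ 2) ^ (κ / 2) := by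
    rw [← Real.rpow_two, ← Real.rpow_mul hx0.le]
    congr 1
    ring
  have hrhs : (1 / (b * (K : ℝ))) ^ (κ / 2) = (b * (K : ℝ)) ^ (-(κ / 2)) := by
    rw [one_div, Real.inv_rpow hA.le, Real.rpow_neg hA.le]
  rw [hlhs, ← hrhs]
  exact hpow

/-- The bare-coupling remnant profile `K ↦ R·(bK)^{−κ∕2}` is antitone on positive run lengths (`R ≥ 0`, `b > 0`, `κ ≥ 0`). [folklore] -/
theorem bareRemnant_antitone {R b κ : ℝ} (hR : 0 ≤ R) (hb : 0 < b) (hκ : 0 ≤ κ) :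
    ∀ m n : ℕ, 1 ≤ m → m ≤ n → R * (b * (n : ℝ)) ^ (-(κ / 2)) ≤ R * (b * (m : ℝ)) ^ (-(κ / 2)) := by
  intro m n hm hmn
  have hm' : 0 < b * (m : ℝ) := mul_pos hb (by exact_mod_cast hm)
  have hn' : 0 < b * (n : ℝ) := mul_pos hb (by exact_mod_cast (hm.trans hmn))
  have hle : b * (m : ℝ) ≤ b * (n : ℝ) := mul_le_mul_of_nonneg_left (by exact_mod_cast hmn) hb.le
  exact mul_le_mul_of_nonneg_left
    (Real.antitoneOn_rpow_Ioi_of_exponent_nonpos (by linarith) (Set.mem_Ioi.mpr hm') (Set.mem_Ioi.mpr hn') hle) hR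

/-- The bare-coupling remnant profile is nonnegative. [folklore] -/
theorem bareRemnant_nonneg {R b κ : ℝ} (hR : 0 ≤ R) (hb : 0 < b) (n : ℕ) : 0 ≤ R * (b * (n : ℝ)) ^ (-(κ / 2)) :=
  mul_nonneg hR (Real.rpow_nonneg (mul_nonneg hb.le (Nat.cast_nonneg n)) _)

/-- **NE4 UP TO A BARE-COUPLING REMNANT FEEDS THE ℓ¹ ROAD.**  If ON THE BOX
`|β_{k+2}(g_0,…,g_{k+1}) − β_{k+1}(g_1,…,g_{k+1})| ≤ c·θ^k + R·g_0^κ` (`R ≥ 0`, `κ ≥ 0`; NE4 = the case `R = 0`), then along every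
run `g (K+1)` of (0.20) of length `K+1` with couplings in `]0,γ]` under `BetaLowerH b γ β` (`b > 0`) the along-run β-shift at
scale `j < K` is at most `c·θ^j + R·(b(K+1))^{−κ∕2}` — §2's hypothesis with the run-length remnant `r(K) = R·(bK)^{−κ∕2}`.  The
weakened box hypothesis is an UNPRINTED input, not a claim about [Balaban1987RG1]'s β. [cite: Balaban1987RG1, (0.20) p.256 and (0.31) p.259] -/
theorem shiftAlong_of_bareRemnant {β : HBeta} {γ b c θ R κ : ℝ} {g : ℕ → ℕ → ℝ} (hb : 0 < b) (hR : 0 ≤ R) (hκ : 0 ≤ κ)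
    (hβ : ∀ k (w : Fin (k + 2) → ℝ), w ∈ Box γ (k + 1) → |β (k + 1) w - β k (Fin.tail w)| ≤ c * θ ^ k + R * (w 0) ^ κ)
    (hrun : ∀ K, RGEqH K β (g K)) (hbox : ∀ K i, i ≤ K → 0 < g K i ∧ g K i ≤ γ) (hlo : BetaLowerH b γ β) :
    ∀ K j, j < K →
      |β (j + 1) (prefixOf (g (K + 1)) (j + 1)) - β j (Fin.tail (prefixOf (g (K + 1)) (j + 1)))|
        ≤ c * θ ^ j + R * (b * ((K + 1 : ℕ) : ℝ)) ^ (-(κ / 2)) := by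
  intro K j hj
  have hw : prefixOf (g (K + 1)) (j + 1) ∈ Box γ (j + 1) := prefixOf_mem_box (N := K + 1) (by omega) (hbox (K + 1))
  have h1 := hβ j (prefixOf (g (K + 1)) (j + 1)) hw
  have h0 : (prefixOf (g (K + 1)) (j + 1)) 0 = g (K + 1) 0 := by simp
  rw [h0] at h1
  have h2 : (g (K + 1) 0) ^ κ ≤ (b * ((K + 1 : ℕ) : ℝ)) ^ (-(κ / 2)) :=
    bare_rpow_le_of_betaLower hb hκ (by omega) (hrun (K + 1)) (hbox (K + 1)) hlo
  exact h1.trans (by linarith [mul_le_mul_of_nonneg_left h2 hR])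

/-- p-SERIES CORE: `Σ_K (bK)^{−κ∕2} < ∞ ⟺ κ > 2` for `b > 0` (`Real.summable_nat_rpow`). [folklore] -/
theorem summable_bareRemnant_core {b : ℝ} (hb : 0 < b) (κ : ℝ) :
    Summable (fun n : ℕ => (b * (n : ℝ)) ^ (-(κ / 2))) ↔ 2 < κ := by
  have hfac : ∀ n : ℕ, (b * (n : ℝ)) ^ (-(κ / 2)) = b ^ (-(κ / 2)) * (n : ℝ) ^ (-(κ / 2)) := fun n =>
    Real.mul_rpow hb.le (Nat.cast_nonneg n)
  simp_rw [hfac]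
  rw [summable_mul_left_iff (ne_of_gt (Real.rpow_pos_of_pos hb _)), Real.summable_nat_rpow]
  constructor <;> intro h <;> linarith

/-- **U2 → U6 FROM NE4-UP-TO-A-BARE-REMNANT WITH EXPONENT `κ > 2`.**  As `u6_of_runs_remnant`, with the β-level box hypothesis
`|β_{k+2}(w) − β_{k+1}(tail w)| ≤ c·θ^k + R·(w 0)^κ` (`c, R ≥ 0`, `0 ≤ θ < 1`, `κ > 2`), the all-k lower bound `BetaLowerH b γ β`
(`b > 0`, which is `EventualLowerH b γ 0 β`, so the window reads `C(γ³ + 2γ∕b) ≤ (1−ω)∕2`), history moduli of fading memory,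
IR-pinned runs and node U5 ⇒ node U6's three outputs.  [GawedzkiKupiainen1986]'s printed exponent is `3 − 2ε > 2`; every
hypothesis here is an UNPRINTED input for Bałaban's β. [cite: GawedzkiKupiainen1986, §5 (81), (84), (91) pp.545-546] -/
theorem u6_of_runs_bareRemnant {β : HBeta} {γ b ω C E ρ vol l₀ c θ R κ : ℝ} {Λ : ℕ → ℕ → ℝ} {Z : ℕ → ℝ → ℝ}
    (g : ℕ → ℕ → ℝ) (gIR : ℝ) (hγ : 0 < γ) (hb : 0 < b) (hω0 : 0 < ω) (hω1 : ω < 1) (hC : 0 ≤ C)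
    (hc : 0 ≤ c) (hθ0 : 0 ≤ θ) (hθ1 : θ < 1) (hR : 0 ≤ R) (hκ : 2 < κ)
    (hβ : ∀ k (w : Fin (k + 2) → ℝ), w ∈ Box γ (k + 1) → |β (k + 1) w - β k (Fin.tail w)| ≤ c * θ ^ k + R * (w 0) ^ κ)
    (hrun : ∀ K, RGEqH K β (g K)) (hbox : ∀ K i, i ≤ K → 0 < g K i ∧ g K i ≤ γ) (hpin : ∀ K, g K K = gIR)
    (hL : HistLipschitz Λ γ β) (hΛ : FadingMemory C ω Λ) (hlo : BetaLowerH b γ β)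
    (hsmall : C * (γ ^ 3 + 2 * γ / b) ≤ (1 - ω) / 2)
    (hE : 0 ≤ E) (hρ0 : 0 ≤ ρ) (hρ1 : ρ < 1) (hl₀ : 0 ≤ l₀)
    (hU5 : MatchingModConstants vol l₀ (delta E ρ (fun K j => disc (g K) (g (K + 1)) j)) Z) :
    Summable (delta E ρ (fun K j => disc (g K) (g (K + 1)) j)) ∧
    (∀ t : ℝ, |t| ≤ l₀ → CauchySeq fun K => genFun Z K t) ∧
    TendstoUniformlyOn (fun K t => genFun Z K t) (genFunLim Z) atTop {t | |t| ≤ l₀} := by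
  have hκ0 : 0 ≤ κ := by linarith
  have hsmall' : C * ((((0 : ℕ) : ℝ) + 1) * γ ^ 3 + 2 * γ / b) ≤ (1 - ω) / 2 := by simpa using hsmall
  have hrs : Summable (fun n : ℕ => R * (b * (n : ℝ)) ^ (-(κ / 2))) :=
    ((summable_bareRemnant_core hb κ).mpr hκ).mul_left R
  exact u6_of_runs_remnant (r := fun n : ℕ => R * (b * (n : ℝ)) ^ (-(κ / 2))) g gIR hγ hb hω0 hω1 hC hc hθ0 hθ1
    (bareRemnant_nonneg hR hb) (bareRemnant_antitone hR hb hκ0) hrs hrun hbox hpin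
    (shiftAlong_of_bareRemnant hb hR hκ0 hβ hrun hbox hlo) hL hΛ
    (T4CouplingMatching.eventualLowerH_of_betaLowerH hlo 0) hsmall' hE hρ0 hρ1 hl₀ hU5

/-! ## §4 The exponent threshold -/

/-- **THE THRESHOLD `κ = 2`.**  For `R > 0`, `b > 0`: the bare-coupling remnant `K ↦ R·(bK)^{−κ∕2}` is summable over cutoffs iff
`κ > 2` (p-series).  So §3 covers exactly the exponents `κ > 2` — the range of [GawedzkiKupiainen1986]'s `3 − 2ε` ((81), (84)) and
of the exponents `κ₀ > 2` of [Balaban1988Convergent] (2.44)'s non-contracted sizes `R₁g_j^{κ₀}` (row NE9's `uvTailR_le` books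
the same p-series on the expectation side); at `κ = 2` the profile of §1 is harmonic, not summable, and the ℓ¹ road's threshold
is exact (`NE7MarginalL1Currency.thresholdExact`). [cite: GawedzkiKupiainen1986, §5 (91) p.546] -/
theorem summable_bareRemnant_iff {R b : ℝ} (hR : 0 < R) (hb : 0 < b) (κ : ℝ) :
    Summable (fun n : ℕ => R * (b * (n : ℝ)) ^ (-(κ / 2))) ↔ 2 < κ := by
  rw [summable_mul_left_iff hR.ne', summable_bareRemnant_core hb κ]

/-- **AT THE THRESHOLD THE ℓ¹ ROAD FAILS FOR THE EQUALITY-CASE INJECTION.**  With `κ = 2` the §1 profile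
`σ_j = c·θ^j + R·(b(j+2))^{−1}` (`c ≥ 0`, `0 ≤ θ`, `R > 0`, `b > 0`) is NOT summable, hence the transported totals of the
tail injection `K j ↦ Σ_{i∈[j,K)} σ_i` (which IS tail-dominated by `σ`, `NE7MarginalL1Currency.tailDominated_tailInj`) are not
summable for any `ρ ∈ ]0,1[` — the currency-level witness that §3's `κ > 2` cannot be relaxed on this road. [folklore] -/
theorem not_summable_delta_at_threshold {c θ R b ρ : ℝ} (hc : 0 ≤ c) (hθ0 : 0 ≤ θ) (hR : 0 < R) (hb : 0 < b)
    (hρ0 : 0 < ρ) (hρ1 : ρ < 1) :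
    ¬ Summable (delta 1 ρ (fun K j => ∑ i ∈ Ico j K, (c * θ ^ i + R * (b * ((i + 2 : ℕ) : ℝ)) ^ (-((2 : ℝ) / 2))))) := by
  have hσ0 : ∀ i : ℕ, 0 ≤ c * θ ^ i + R * (b * ((i + 2 : ℕ) : ℝ)) ^ (-((2 : ℝ) / 2)) := fun i =>
    add_nonneg (mul_nonneg hc (pow_nonneg hθ0 i)) (bareRemnant_nonneg hR.le hb (i + 2))
  refine NE7MarginalL1Currency.thresholdExact
    (fun i : ℕ => c * θ ^ i + R * (b * ((i + 2 : ℕ) : ℝ)) ^ (-((2 : ℝ) / 2))) ρ hσ0 hρ0 hρ1 ?_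
  -- the profile dominates the harmonic sequence `R∕(b(i+2))`
  intro hs
  have hrem : Summable (fun i : ℕ => R * (b * ((i + 2 : ℕ) : ℝ)) ^ (-((2 : ℝ) / 2))) := by
    refine Summable.of_nonneg_of_le (fun i => bareRemnant_nonneg hR.le hb (i + 2)) (fun i => ?_) hs
    linarith [mul_nonneg hc (pow_nonneg hθ0 i)]
  have hall : Summable (fun n : ℕ => R * (b * (n : ℝ)) ^ (-((2 : ℝ) / 2))) :=
    (summable_nat_add_iff (f := fun n : ℕ => R * (b * (n : ℝ)) ^ (-((2 : ℝ) / 2))) 2).mp hrem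
  have h22 : (2 : ℝ) < 2 := (summable_bareRemnant_iff hR hb 2).mp hall
  exact absurd h22 (lt_irrefl _)

/-! ## §5 (v1.1) The memory companion already forbids a bare-coupling remnant on the box

CORRECTION OF §3's FRAMING (same generation, second pass).  §3–§4 state the tolerance of the ℓ¹ bound ALONG RUNS: a remnant
`R·g_0^κ` read through `shiftAlong_of_bareRemnant` is summable over cutoffs iff `κ > 2`.  But node U2's road consumes the
history companion `HistLipschitz Λ γ β` with `FadingMemory C ω Λ` anyway, and under that companion the β-LEVEL box hypothesis
of §3 is NO WEAKENING AT ALL: the influence of the oldest coupling `g_0` on `β_{k+2}` is Lipschitz with constant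
`Λ (k+1) 0 ≤ C·ω^{k+1}`, so sliding `g_0 → 0⁺` in the box (the tail is unchanged, `Fin.tail_update_zero`) kills the remnant
`R·g_0^κ` (`κ > 0`) at the price `C·γ·ω^{k+1}` — i.e. `ScaleShiftRate (c + Cγω) (max θ ω) γ β` holds outright, for EVERY
`κ > 0`, and the geometric road applies with no exponent condition.  What §1–§2 tolerate beyond NE4 is therefore a remnant
that is NOT a function on the box — one depending on the RUN LENGTH (the cutoff index), as [GawedzkiKupiainen1986]'s
ultraviolet-pinning remnant `β(M)^{−3∕2+ε}` does — and for such remnants the summability threshold of §4 stands (at the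
currency level).  The exponent `κ > 2` of `u6_of_runs_bareRemnant` is a property of the ℓ¹ bound along runs, not a threshold
of provability. -/

/-- **UNDER FADING MEMORY A BARE-COUPLING REMNANT ON THE BOX IS ABSENT.**  If ON THE BOX
`|β_{k+2}(w) − β_{k+1}(Fin.tail w)| ≤ c·θ^k + R·(w 0)^κ` with `κ > 0`, `R ≥ 0`, and the history moduli `HistLipschitz Λ γ β` have
`FadingMemory C ω Λ` (`C, ω ≥ 0`), then NE4 ITSELF holds: `ScaleShiftRate (c + C·γ·ω) (max θ ω) γ β` (`c, θ ≥ 0`, `γ > 0`).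
Proof: replace `w 0` by `ε ∈ ]0,γ]` — the tail, hence `β_{k+1}(Fin.tail w)`, is unchanged; `β_{k+2}` moves by at most
`Λ (k+1) 0·|w 0 − ε| ≤ C·ω^{k+1}·γ`; the remnant at `ε` is `R·ε^κ → 0`.  So the box form of §3 is no weaker than NE4 once node U2's
memory companion is in force; only run-length (cutoff-indexed) remnants, §1–§2, go beyond NE4. [folklore] -/
theorem scaleShiftRate_of_bareRemnant_fadingMemory {β : HBeta} {γ c θ R κ C ω : ℝ} {Λ : ℕ → ℕ → ℝ}
    (hγ : 0 < γ) (hc : 0 ≤ c) (hθ0 : 0 ≤ θ) (hR : 0 ≤ R) (hκ : 0 < κ) (hC : 0 ≤ C) (hω0 : 0 ≤ ω)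
    (hβ : ∀ k (w : Fin (k + 2) → ℝ), w ∈ Box γ (k + 1) → |β (k + 1) w - β k (Fin.tail w)| ≤ c * θ ^ k + R * (w 0) ^ κ)
    (hL : HistLipschitz Λ γ β) (hΛ : FadingMemory C ω Λ) :
    T4CouplingMatching.ScaleShiftRate (c + C * γ * ω) (max θ ω) γ β := by
  intro k w hw
  have hwi : ∀ i, 0 < w i ∧ w i ≤ γ := mem_box.mp hw
  -- the bound with the remnant evaluated at any `ε ∈ ]0,γ]` in place of `w 0`
  have hslide : ∀ ε, 0 < ε → ε ≤ γ → |β (k + 1) w - β k (Fin.tail w)| ≤ c * θ ^ k + C * γ * ω ^ (k + 1) + R * ε ^ κ := by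
    intro ε hε0 hεγ
    set w' : Fin (k + 2) → ℝ := Function.update w 0 ε with hw'def
    have hw' : w' ∈ Box γ (k + 1) := by
      refine mem_box.mpr fun i => ?_
      by_cases hi : i = 0
      · subst hi; simp [hw'def, hε0, hεγ]
      · simp only [hw'def, Function.update_of_ne hi]; exact hwi i
    have htail : Fin.tail w' = Fin.tail w := by rw [hw'def, Fin.tail_update_zero]
    have h1 : |β (k + 1) w' - β k (Fin.tail w)| ≤ c * θ ^ k + R * ε ^ κ := by
      have := hβ k w' hw'
      rw [htail] at this
      simpa [hw'def] using this
    -- the Lipschitz move in the oldest coordinate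
    have h2 : |β (k + 1) w - β (k + 1) w'| ≤ C * γ * ω ^ (k + 1) := by
      have hLk := hL (k + 1) w w' hw hw'
      have hsum : ∑ i : Fin (k + 2), Λ (k + 1) i * |w i - w' i| = Λ (k + 1) 0 * |w 0 - ε| := by
        rw [Fin.sum_univ_succ]
        have h0 : w' 0 = ε := by simp [hw'def]
        have hrest : ∑ i : Fin (k + 1), Λ (k + 1) i.succ * |w i.succ - w' i.succ| = 0 := by
          refine Finset.sum_eq_zero fun i _ => ?_
          have : w' i.succ = w i.succ := by
            simp only [hw'def, Function.update_of_ne (Fin.succ_ne_zero i)]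
          rw [this, sub_self, abs_zero, mul_zero]
        rw [hrest, h0, add_zero]
        simp
      rw [hsum] at hLk
      have hΛ0 := hΛ (k + 1) 0 (Nat.zero_le _)
      have hdist : |w 0 - ε| ≤ γ := by
        rw [abs_sub_le_iff]; constructor <;> linarith [(hwi 0).1, (hwi 0).2]
      have hpow : Λ (k + 1) ((0 : Fin (k + 2)) : ℕ) ≤ C * ω ^ (k + 1) := by simpa using hΛ0.2
      have hΛnn : 0 ≤ Λ (k + 1) ((0 : Fin (k + 2)) : ℕ) := by simpa using hΛ0.1
      calc |β (k + 1) w - β (k + 1) w'| ≤ Λ (k + 1) ((0 : Fin (k + 2)) : ℕ) * |w 0 - ε| := hLk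
        _ ≤ C * ω ^ (k + 1) * γ := mul_le_mul hpow hdist (abs_nonneg _) (by positivity)
        _ = C * γ * ω ^ (k + 1) := by ring
    calc |β (k + 1) w - β k (Fin.tail w)|
        = |(β (k + 1) w - β (k + 1) w') + (β (k + 1) w' - β k (Fin.tail w))| := by ring_nf
      _ ≤ |β (k + 1) w - β (k + 1) w'| + |β (k + 1) w' - β k (Fin.tail w)| := abs_add_le _ _
      _ ≤ C * γ * ω ^ (k + 1) + (c * θ ^ k + R * ε ^ κ) := add_le_add h2 h1
      _ = c * θ ^ k + C * γ * ω ^ (k + 1) + R * ε ^ κ := by ring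
  -- let `ε → 0⁺`
  have hlim : |β (k + 1) w - β k (Fin.tail w)| ≤ c * θ ^ k + C * γ * ω ^ (k + 1) := by
    refine le_of_forall_pos_le_add fun η hη => ?_
    set η' : ℝ := η / (R + 1) with hη'def
    have hη' : 0 < η' := by positivity
    set ε : ℝ := min γ (η' ^ κ⁻¹) with hεdef
    have hε0 : 0 < ε := lt_min hγ (Real.rpow_pos_of_pos hη' _)
    have hεγ : ε ≤ γ := min_le_left _ _
    have hεκ : ε ^ κ ≤ η' := by
      calc ε ^ κ ≤ (η' ^ κ⁻¹) ^ κ := Real.rpow_le_rpow hε0.le (min_le_right _ _) hκ.le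
        _ = η' := Real.rpow_inv_rpow hη'.le hκ.ne'
    have hRε : R * ε ^ κ ≤ η := by
      calc R * ε ^ κ ≤ R * η' := mul_le_mul_of_nonneg_left hεκ hR
        _ ≤ (R + 1) * η' := mul_le_mul_of_nonneg_right (by linarith) hη'.le
        _ = η := by rw [hη'def]; field_simp
    linarith [hslide ε hε0 hεγ]
  -- absorb both geometric terms into the rate `max θ ω`
  have hm0 : 0 ≤ max θ ω := le_max_of_le_left hθ0
  have hθk : θ ^ k ≤ (max θ ω) ^ k := pow_le_pow_left₀ hθ0 (le_max_left _ _) k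
  have hωk : ω ^ (k + 1) ≤ ω * (max θ ω) ^ k := by
    rw [pow_succ']
    exact mul_le_mul_of_nonneg_left (pow_le_pow_left₀ hω0 (le_max_right _ _) k) hω0
  calc |β (k + 1) w - β k (Fin.tail w)| ≤ c * θ ^ k + C * γ * ω ^ (k + 1) := hlim
    _ ≤ c * (max θ ω) ^ k + C * γ * (ω * (max θ ω) ^ k) :=
        add_le_add (mul_le_mul_of_nonneg_left hθk hc) (mul_le_mul_of_nonneg_left hωk (by positivity))
    _ = (c + C * γ * ω) * (max θ ω) ^ k := by ring

end Summit.QuantumFields.BalabanUV.T4Continuum.Spine.NE4.ScaleShiftRemnant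

end
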